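import Literature.AlgebraicGeometry.Resolution.LogRegularAtlasGluing
import Literature.AlgebraicGeometry.Resolution.DivisorialMonoid
import Literature.AlgebraicGeometry.Resolution.MarkedIdealsLemmas
import Literature.AlgebraicGeometry.Resolution.NormalizationInExtension
import Literature.AlgebraicGeometry.Resolution.LogRegularResolution
import HarnessLib

set_option linter.dupNamespace false -- mandated namespace of this single-conjunct summit

/-!
# Local log-regular charts off the boundary: the trivial chart on the regular locus

Crux `Picover` (stmt-ResolutionOfSingularities-0554), line `giraud-separated-base`, stub
`localChartSep_of_regular_off_boundary` — the off-boundary piece of `stub_localChartsSep`. On the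
normalised cover `W'^L = normalizationIn W' L` of an integral scheme `W'` in a field extension
`L` of its function field, with boundary the list `E` of ideal sheaves on `W'` pulled back along
`ι : W'^L → W'`, the prescribed stalk monoid at `y` is the divisorial monoid of the stalk of the
boundary ideal `∏_{D ∈ E} D_{ι y} · 𝒪_{W'^L, y}`. At a point `y` having a neighbourhood `U` on which
the cover is regular and which misses the boundary, the TRIVIAL chart (`n = 0`, `P = ℤ⁰`,
`φ = 1`; Kato 1994, (2.2)(1)) on an affine open `V` with `y ∈ V ⊆ U` is a local log-regular chart
for this family:

* it is log regular at a prime `𝔭` of `Γ(V)` iff the localisation `Γ(V)_𝔭` is regular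
  (`LogChart.isLogRegularAt_trivial_iff`), and that localisation is the stalk at the point of `V`
  corresponding to `𝔭`, regular by hypothesis (`isRegularLocalRing_localization_of_forall_mem`);
* its stalk monoids are the units (`chartStalkMonoid_one`), and so are the prescribed ones: off
  the boundary every stalk `D_{ι y'}` is the unit ideal (`stalkIdeal_eq_top_of_not_mem_support`),
  hence so is their product and its extension, whose divisorial monoid is the group of units
  (`divisorialMonoid_top`).
-/

noncomputable section

open CategoryTheory AlgebraicGeometry TopologicalSpace Literature.AlgebraicGeometry.Resolution

universe u

namespace Summit.ResolutionOfSingularities.ResolutionOfSingularities.Theorems.Picover.LocalChartOffBoundary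

/-- If all stalks of `X` at the points of an affine open `U` are regular local rings, then the
localisation of `Γ(X, U)` at any prime `𝔭` is regular: it is the stalk at the point of `U`
corresponding to `𝔭` (`IsAffineOpen.isLocalization_stalk`). [folklore] -/
-- adapted from `isRegularLocalRing_localization_of_isRegular` (LogRegularAtlasGluing.lean)
theorem isRegularLocalRing_localization_of_forall_mem {X : Scheme.{u}} (U : X.affineOpens)
    (hreg : ∀ y ∈ (U : X.Opens), IsRegularLocalRing (X.presheaf.stalk y))
    (𝔭 : Ideal Γ(X, (U : X.Opens))) [𝔭.IsPrime] :
    IsRegularLocalRing (Localization.AtPrime 𝔭) := by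
  obtain ⟨y, hy⟩ : ∃ y : (U : X.Opens), U.2.primeIdealOf y = ⟨𝔭, inferInstance⟩ :=
    ⟨⟨U.2.fromSpec ⟨𝔭, inferInstance⟩, U.2.range_fromSpec.le ⟨_, rfl⟩⟩, by
      apply U.2.fromSpec.isOpenEmbedding.injective
      rw [U.2.fromSpec_primeIdealOf]⟩
  haveI := U.2.isLocalization_stalk y
  haveI := hreg (y : X) y.2
  have e := (IsLocalization.algEquiv (U.2.primeIdealOf y).asIdeal.primeCompl
    (X.presheaf.stalk (y : X)) (Localization.AtPrime (U.2.primeIdealOf y).asIdeal)).toRingEquiv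
  rw [hy] at e
  exact IsRegularLocalRing.of_ringEquiv e

/-- **The trivial chart on the regular locus with trivial log structure** (Kato 1994, (2.2)(1)).
If `x` has a neighbourhood `U` on which all stalks are regular and on which the prescribed stalk
monoids `M y` are the units, then there is a local log-regular chart at `x` for `M`: the trivial
chart `n = 0`, `P = ℤ⁰`, `φ = 1` on an affine open `V` with `x ∈ V ⊆ U` — log regular at `𝔭` iff
`Γ(V)_𝔭` is regular (`LogChart.isLogRegularAt_trivial_iff`), with stalk monoids the units
(`chartStalkMonoid_one`). [cite: Kato1994, (2.2)(1)] -/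
theorem nonempty_localLogRegularChart_of_units {X : Scheme.{u}}
    (M : ∀ x : X, Submonoid (X.presheaf.stalk x)) (x : X) (U : X.Opens) (hxU : x ∈ U)
    (hreg : ∀ y ∈ U, IsRegularLocalRing (X.presheaf.stalk y))
    (hM : ∀ y ∈ U, M y = IsUnit.submonoid (X.presheaf.stalk y)) :
    Nonempty (LocalLogRegularChart X M x) := by
  obtain ⟨V, hV, hxV, hVU⟩ := exists_isAffineOpen_mem_and_subset hxU
  exact ⟨{ U := ⟨V, hV⟩
           mem := hxV
           n := 0
           P := ⊤
           φ := 1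
           fg := (AddSubmonoid.fg_iff _).mpr ⟨_, AddSubmonoid.closure_eq ⊤, Set.toFinite _⟩
           saturated := fun _ _ _ _ => trivial
           span_eq_top := by simp
           isLogRegularAt := fun 𝔭 _ => (LogChart.isLogRegularAt_trivial_iff _ _ _).mpr
             (isRegularLocalRing_localization_of_forall_mem ⟨V, hV⟩
               (fun y hy => hreg y (hVU hy)) 𝔭)
           chartStalkMonoid_eq := fun y hy => by
             rw [chartStalkMonoid_one, hM y (hVU hy)] }⟩

/-- Off the support of every member of a list `E` of ideal sheaves, the product of the stalks
is the unit ideal. [folklore] -/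
theorem prod_map_stalkIdeal_eq_top {Y : Scheme.{u}} (E : List Y.IdealSheafData) (w : Y)
    (hoff : ∀ D ∈ E, w ∉ D.support) :
    (E.map fun D => stalkIdeal D w).prod = ⊤ := by
  rw [← Ideal.one_eq_top]
  refine List.prod_eq_one fun I hI => ?_
  obtain ⟨D, hD, rfl⟩ := List.mem_map.mp hI
  rw [Ideal.one_eq_top]
  exact stalkIdeal_eq_top_of_not_mem_support (hoff D hD)

/-- **Local log-regular charts off the boundary** (the off-boundary piece of
`stub_localChartsSep`, line `giraud-separated-base`). On the normalised cover
`W'^L = normalizationIn W' L`, with prescribed stalk monoids the divisorial monoids of the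
pulled-back boundary `∏_{D ∈ E} D_{ι y} · 𝒪_{W'^L,y}`: at a point `y` with a neighbourhood `U`
on which the cover is regular and which lies off the boundary (`ι y' ∉ supp D` for all
`y' ∈ U`, `D ∈ E`), the trivial chart (Kato 1994, (2.2)(1)) on an affine open `y ∈ V ⊆ U` is a
local log-regular chart — off the boundary each `D_{ι y'} = ⊤`
(`stalkIdeal_eq_top_of_not_mem_support`), so the prescribed monoid is
`divisorialMonoid ⊤ =` the units (`divisorialMonoid_top`), which is the stalk monoid of the
trivial chart (`chartStalkMonoid_one`). [cite: Kato1994, (2.2)(1)] -/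
theorem localChartSep_of_regular_off_boundary : ∀ (W' : Scheme.{0}) [IsIntegral W'] (L : Type) [Field L] [Algebra W'.functionField L] [IsLocallyNoetherian (normalizationIn W' L)] (E : List W'.IdealSheafData) (y : ↥(normalizationIn W' L)) (U : (normalizationIn W' L).Opens), y ∈ U → (∀ y' ∈ U, IsRegularLocalRing ((normalizationIn W' L).presheaf.stalk y')) → (∀ y' ∈ U, ∀ D ∈ E, (normalizationInι W' L).base y' ∉ D.support) → Nonempty (LocalLogRegularChart (normalizationIn W' L) (fun y => divisorialMonoid (((E.map fun D => stalkIdeal D ((normalizationInι W' L).base y))).prod.map ((normalizationInι W' L).stalkMap y).hom)) y) := by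
  intro W' _ L _ _ _ E y U hyU hreg hoff
  refine nonempty_localLogRegularChart_of_units _ y U hyU hreg fun y' hy' => ?_
  show divisorialMonoid _ = _
  rw [prod_map_stalkIdeal_eq_top E _ (hoff y' hy'), Ideal.map_top, divisorialMonoid_top]

end Summit.ResolutionOfSingularities.ResolutionOfSingularities.Theorems.Picover.LocalChartOffBoundary

end
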